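import Summits.QuantumFields.YangMills.Theorems.BalabanUVNodesN15TwoSpacingGluingNeumannKnitRightDefectCube
import Summits.QuantumFields.YangMills.Theorems.BalabanUVNodesN15TwoSpacingGluingNeumannKnitRightNonlocal
import HarnessLib

/-!
# THE GLUING STEP AT TWO LATTICE SPACINGS, LXIII: THE TWO-GRID η-DEFECT OF A CUT CUBE's ADJOINT REMAINDER ROW FOR ANY CUBE OPERATOR, FROM SANDWICHES — LOCAL PART PROVED,
# SANDWICH OPERATORS ∕ IDENTITIES ∕ ROWS ∕ DEFECTS AND THE NONLOCAL PART AS BINDERS (dag-n15-c g14, FILE 105; N15 = NE2, s1 «background-layer OPERATOR ingredient»)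

Cell `pub-ymgap`, seat `pub-ymgap-dag-n15-c` (R134 (a); HUMAN RULING D-0062), generation 14.  `bears_on: R4∕N15 · K3⁸ SpineGivenEndpointR13SepCoPHV (stmt-QuantumFields-27366)`.
Filed `--supports stmt-QuantumFields-27366 --as helper` — COUNT-NEUTRAL.  Theorems only (0 `def`, 0 `sorry`).  Imports BY NAME FILE 97 `…NeumannKnitRightDefectCube` (§1
`hasMaj_idef_comp_commOp_lapOp_of_sandwich`; through it FILES 45–91: `idef` calculus, FILE 49 `comp_commOp_lapOp`, FILE 64∕65 two-grid fits of the partition, FILE 67 letters, FILE 69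
`deltaOp_eq_lapOp_zero_add`, FILE 74 `coverFit_params`, `loc₂_le_loc₁`) and FILE 100 `…NeumannKnitRightNonlocal` (FILE 56 `hasMaj_idef_commOp_nonlocal` ∕ `hasMaj_commOp_nonlocal`,
FILE 57 `hasMaj_comp_exp_out`, FILE 67 moduli, FILE 69 `hasMaj_nonlocalPart`, `coverHb_eq_of_spacing`, `blockOf_fine_eq`); nothing in the tree is modified.

WHAT.  ★★★ **`hasMaj_idef_cut_comp_commOp_deltaOp_of_sandwich`** — FILE 97 §2 `hasMaj_idef_chiCube_neumannCubeG_comp_commOp_deltaOp` made GENERIC IN THE CUBE OPERATOR (programme R, the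
torus of record: the cube operator there is dag-n15-a's LIFTED Neumann cube `liftCubeG`, not the images cube of the doubled torus).  On `M_ν = 2qw` with FILE 67's partition `h_k = hcube (2q) ξ k`
at two spacings `L^{−K}` ⊃ `L^{−(K+r)}` (King's pairing `π`), for ANY pair of cut cube operators `M_χG_c`, `M_{χ′}G′_c` (cube `c`, side `S` — only the indicator is used) and ANY sandwich operators
`T^±_μ`, `T′^±_μ` with `(M_χG_c)∘∇_μ∘M_{(∇_μh)∘e⁻¹} = T⁺_μ∘M_{…}`, `(M_χG_c)∘∇⁻_μ∘M_{(∇⁻_μh)∘e} = T⁻_μ∘M_{…}` (both spacings), displayed fine two-sided rows `M_{χ′}G′_c ≤ 1_□1_□βe^{−δ₀d}`,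
`T′^± ≤ 1_□1_□β₁e^{−δ₀d}`, two-sided defects `𝔇(M_{χ′}G′_c, M_χG_c) ≤ 1_□1_□m_Ge^{−δ₀d}`, `𝔇(T′^±_μ, T^±_μ) ≤ 1_□1_□m₁e^{−δ₀d}` and the displayed defect of the nonlocal part
`𝔇((M_{χ′}G′_c)∘[N′_L, M_{h′}], (M_χG_c)∘[N_L, M_h]) ≤ 1_□(y)·r_N·e^{−ρd}` (`N_L = aQ*Q − ∂Π∂*`, `ρ ≤ δ₀`):
  `𝔇((M_{χ′}G′_c)∘[Δ′_a, M_{h′}], (M_χG_c)∘[Δ_a, M_h]) ≤ 1_□(y)·((d+1)(3(βo₂ + m_Gc₂) + 2(β₁o₁ + m₁c₁)) + 0 + r_N)·e^{−ρd}`,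
`c₁ = π∕w`, `c₂ = 32π²∕w²`, `o₁ = w⁻¹(L^Kw)⁻¹(64 + (d+1))π²`, `o₂ = w⁻²(L^Kw)⁻¹(144 + 32(d+1))π³` — FILE 97 §1 fed with FILE 67's letters and FILE 64∕65's two-grid fits of `∇h`, `∇⁻h`, `∇*∇h`; the
sandwich identities, which on the doubled torus were dag-n15-a N-IIn's, are BINDERS here (on the torus of record they are programme P's `χ_□∘G^{↑}∘∇^±∘M_g = transplant(…)∘M_g`).
★★★ **`hasMaj_idef_cut_comp_commOp_nonlocal_of_row`** — FILE 100 §2 made generic in the cube operator the same way (the fine two-sided cut row displayed): the defect of the cut row against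
the commutator of the nonlocal part `N_L = aQ*Q − ∂Π∂*`, from FILE 99's operator letter `𝔇(N′_L, N_L)`, the two-sided `𝔇(M_{χ′}G′_c, M_χG_c)` and the `∂Π∂*` letters.

HONEST FRAMING ∕ LIMITS.  Operator algebra + block-majorant bookkeeping over DISPLAYED rows; every analytic letter is a binder; constants crude and ours; nothing of [B5]∕[B6] (2.38)–(2.40)∕[B9]
Thm 3.1, 3.14 asserted ([B9] Thm 3.14 = difference TEMPLATE).  NE2⁺ NOT PRINTED, NOT proved; N15 NOT discharged; counts of record UNMOVED (typed 28∕28 · discharged 5∕27); one finite 𝕋⁴ at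
fixed ε per index — NOT infinite volume, NOT OS on ℝ⁴, NOT a mass gap, NOT Clay; R4 closes `BalabanLadder.UV` only.  Restate-immune (no Theses import).
-/

noncomputable section

namespace Summit.QuantumFields.YangMills.BalabanUVNodes.N15.Gluing

open Literature.MathematicalPhysics.QuantumFieldTheory.Balaban1983to89
open Literature.MathematicalPhysics.QuantumFieldTheory.Balaban1983to89.B5Prop11Plancherel (Tor fine unitVec)
open Literature.MathematicalPhysics.QuantumFieldTheory.Balaban1983to89.B11SectG (BlockNorm HasMaj hasMaj_zero)
open Literature.MathematicalPhysics.QuantumFieldTheory.Balaban1983to89.B6Prop26Gluing (mulOp ind ind_nonneg ind_le_one)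
open Literature.MathematicalPhysics.QuantumFieldTheory.Balaban1983to89.T4EtaRateDefect (idef idef_comp idef_add idef_sub idef_zero)
open Literature.MathematicalPhysics.QuantumFieldTheory.Balaban1983to89.T4EtaRateCoeffDefect (pull diagK hasMaj_mulOp hasMaj_idef_mulOp)
open Literature.MathematicalPhysics.QuantumFieldTheory.Balaban1983to89.B6UnitTorusCarrier (unitTorusGeo triangle254_unitTorusGeo rowSum_unitTorusGeo unitTorusGeo_dist_nonneg
  unitTorusGeo_dist_symm)
open Literature.MathematicalPhysics.QuantumFieldTheory.King1986.Torus (blockOf tdistT tdistT_nonneg)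
open Summit.QuantumFields.YangMills.BalabanUVNodes.N15.VectorPiece (bshiftEquiv bshiftEquiv_apply bshiftEquiv_symm_apply kingPrV blkFine)
open Summit.QuantumFields.YangMills.BalabanUVNodes.N15.BackgroundLayer (fgrad fgradAdj bgrad fgrad_apply fgradAdj_apply bgrad_apply)
open Summit.QuantumFields.YangMills.BalabanUVNodes.N15.TwoGrid (paramsOf deltaOp chiCube cubeBlocks landauRe qvRe qvAdjRe symbOp)

variable {d : ℕ}

/-! ## The cut cube's adjoint remainder defect, generic in the cube operator and in the sandwiches -/

section Cube

open Real

variable {M : Fin (d + 1) → ℕ} [∀ μ, NeZero (M μ)] {L kk r w q : ℕ} [NeZero L]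

/-- ★★★ **THE TWO-GRID η-DEFECT OF A CUT CUBE's ADJOINT REMAINDER ROW, GENERIC IN THE CUBE OPERATOR — LOCAL PART PROVED, SANDWICHES AND NONLOCAL PART DISPLAYED.**  On `M_ν = 2qw`,
partition `h_k` of FILE 67 at two spacings `L^{−K}` ⊃ `L^{−(K+r)}` (`3 ≤ L^Kw`), any cut cube operators `M_χG_c`, `M_{χ′}G′_c` (cube `c`, side `S`), any sandwich operators `T^±_μ`, `T′^±_μ`
with the four sandwich identities, the displayed fine rows (`β`, `β₁` at rate `δ₀`), two-sided defects (`m_G`, `m₁`) and the nonlocal part's defect (`r_N` at rate `ρ ≤ δ₀`):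
  `𝔇((M_{χ′}G′_c)∘[Δ′_a, M_{h′}], (M_χG_c)∘[Δ_a, M_h]) ≤ 1_□(y)·((d+1)(3(βo₂ + m_Gc₂) + 2(β₁o₁ + m₁c₁)) + 0 + r_N)·e^{−ρd}`
(`c₁ = π∕w`, `c₂ = 32π²∕w²`, `o₁ = w⁻¹(L^Kw)⁻¹(64 + (d+1))π²`, `o₂ = w⁻²(L^Kw)⁻¹(144 + 32(d+1))π³`) — FILE 97 §1 with FILE 67's letters and FILE 64∕65's fits (the shifted coefficients reduce to
`∇h`, `∇⁻h`, `∇*∇h`: `(∇h)∘e⁻¹ = ∇⁻h`, `(∇⁻h)∘e = ∇h`, `(∇∇h)∘e⁻¹ = −∇*∇h`), the `W = 0` part of `Δ_a = −∇*∇ + N_L` defect-free, the nonlocal part added.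
[cite: Balaban1984PropagatorsII, (2.133)–(2.135) p.247 (shapes, transposed); Balaban1985BackgroundPropagators, Thm 3.14 pp.426–427 (difference template); Balaban1984PropagatorsII, (2.36)
p.229 (partition letters)] -/
theorem hasMaj_idef_cut_comp_commOp_deltaOp_of_sandwich (hM : ∀ ν, M ν = 2 * q * w) (hw : 0 < w) (h3 : 3 ≤ L ^ kk * w) (k : Fin (d + 1) → ZMod (2 * q)) (c : Tor M) (S : ℕ)
    {Gc : (Tor (fine (L ^ kk) M) × Fin (d + 1) → ℝ) →ₗ[ℝ] (Tor (fine (L ^ kk) M) × Fin (d + 1) → ℝ)}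
    {Gc' : (Tor (fine (L ^ r * L ^ kk) M) × Fin (d + 1) → ℝ) →ₗ[ℝ] (Tor (fine (L ^ r * L ^ kk) M) × Fin (d + 1) → ℝ)}
    {TD TB : Fin (d + 1) → (Tor (fine (L ^ kk) M) × Fin (d + 1) → ℝ) →ₗ[ℝ] (Tor (fine (L ^ kk) M) × Fin (d + 1) → ℝ)}
    {TD' TB' : Fin (d + 1) → (Tor (fine (L ^ r * L ^ kk) M) × Fin (d + 1) → ℝ) →ₗ[ℝ] (Tor (fine (L ^ r * L ^ kk) M) × Fin (d + 1) → ℝ)}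
    {a β δ₀ β₁ mG m₁ rN ρ : ℝ} (hβ : 0 ≤ β) (hβ₁ : 0 ≤ β₁) (hmG : 0 ≤ mG) (hm₁ : 0 ≤ m₁) (hρδ : ρ ≤ δ₀)
    -- the sandwich identities at both spacings
    (hsD : ∀ μ : Fin (d + 1), (mulOp (chiCube M (L ^ kk) c S) ∘ₗ Gc) ∘ₗ
      fgrad ((L ^ kk : ℕ) : ℝ) (bshiftEquiv M (L ^ kk) μ) ∘ₗ mulOp (fgrad ((L ^ kk : ℕ) : ℝ) (bshiftEquiv M (L ^ kk) μ) (hcube (2 * q) (coverXi M (L ^ kk) w) k) ∘ ⇑(bshiftEquiv M (L ^ kk) μ).symm) =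
      TD μ ∘ₗ mulOp (fgrad ((L ^ kk : ℕ) : ℝ) (bshiftEquiv M (L ^ kk) μ) (hcube (2 * q) (coverXi M (L ^ kk) w) k) ∘ ⇑(bshiftEquiv M (L ^ kk) μ).symm))
    (hsB : ∀ μ : Fin (d + 1), (mulOp (chiCube M (L ^ kk) c S) ∘ₗ Gc) ∘ₗ
      bgrad ((L ^ kk : ℕ) : ℝ) (bshiftEquiv M (L ^ kk) μ) ∘ₗ mulOp (bgrad ((L ^ kk : ℕ) : ℝ) (bshiftEquiv M (L ^ kk) μ) (hcube (2 * q) (coverXi M (L ^ kk) w) k) ∘ ⇑(bshiftEquiv M (L ^ kk) μ)) =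
      TB μ ∘ₗ mulOp (bgrad ((L ^ kk : ℕ) : ℝ) (bshiftEquiv M (L ^ kk) μ) (hcube (2 * q) (coverXi M (L ^ kk) w) k) ∘ ⇑(bshiftEquiv M (L ^ kk) μ)))
    (hsD' : ∀ μ : Fin (d + 1), (mulOp (chiCube M (L ^ r * L ^ kk) c S) ∘ₗ Gc') ∘ₗ
      fgrad ((L ^ r * L ^ kk : ℕ) : ℝ) (bshiftEquiv M (L ^ r * L ^ kk) μ) ∘ₗ
        mulOp (fgrad ((L ^ r * L ^ kk : ℕ) : ℝ) (bshiftEquiv M (L ^ r * L ^ kk) μ) (hcube (2 * q) (coverXi M (L ^ r * L ^ kk) w) k) ∘ ⇑(bshiftEquiv M (L ^ r * L ^ kk) μ).symm) =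
      TD' μ ∘ₗ mulOp (fgrad ((L ^ r * L ^ kk : ℕ) : ℝ) (bshiftEquiv M (L ^ r * L ^ kk) μ) (hcube (2 * q) (coverXi M (L ^ r * L ^ kk) w) k) ∘ ⇑(bshiftEquiv M (L ^ r * L ^ kk) μ).symm))
    (hsB' : ∀ μ : Fin (d + 1), (mulOp (chiCube M (L ^ r * L ^ kk) c S) ∘ₗ Gc') ∘ₗ
      bgrad ((L ^ r * L ^ kk : ℕ) : ℝ) (bshiftEquiv M (L ^ r * L ^ kk) μ) ∘ₗ
        mulOp (bgrad ((L ^ r * L ^ kk : ℕ) : ℝ) (bshiftEquiv M (L ^ r * L ^ kk) μ) (hcube (2 * q) (coverXi M (L ^ r * L ^ kk) w) k) ∘ ⇑(bshiftEquiv M (L ^ r * L ^ kk) μ)) =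
      TB' μ ∘ₗ mulOp (bgrad ((L ^ r * L ^ kk : ℕ) : ℝ) (bshiftEquiv M (L ^ r * L ^ kk) μ) (hcube (2 * q) (coverXi M (L ^ r * L ^ kk) w) k) ∘ ⇑(bshiftEquiv M (L ^ r * L ^ kk) μ)))
    -- the fine two-sided rows
    (hGc' : HasMaj (BlockNorm.ofBlocks (unitTorusGeo L kk M) (fun x : Tor (fine (L ^ r * L ^ kk) M) × Fin (d + 1) => blockOf (L ^ r * L ^ kk) M x.1))
      (BlockNorm.ofBlocks (unitTorusGeo L kk M) (fun x : Tor (fine (L ^ r * L ^ kk) M) × Fin (d + 1) => blockOf (L ^ r * L ^ kk) M x.1))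
      (mulOp (chiCube M (L ^ r * L ^ kk) c S) ∘ₗ Gc')
      (fun y y' => ind ((cubeBlocks M c S : Finset _) : Set _) y * ind ((cubeBlocks M c S : Finset _) : Set _) y' * (β * Real.exp (-(δ₀ * tdistT M y y')))))
    (hTD' : ∀ μ, HasMaj (BlockNorm.ofBlocks (unitTorusGeo L kk M) (fun x : Tor (fine (L ^ r * L ^ kk) M) × Fin (d + 1) => blockOf (L ^ r * L ^ kk) M x.1))
      (BlockNorm.ofBlocks (unitTorusGeo L kk M) (fun x : Tor (fine (L ^ r * L ^ kk) M) × Fin (d + 1) => blockOf (L ^ r * L ^ kk) M x.1)) (TD' μ)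
      (fun y y' => ind ((cubeBlocks M c S : Finset _) : Set _) y * ind ((cubeBlocks M c S : Finset _) : Set _) y' * (β₁ * Real.exp (-(δ₀ * tdistT M y y')))))
    (hTB' : ∀ μ, HasMaj (BlockNorm.ofBlocks (unitTorusGeo L kk M) (fun x : Tor (fine (L ^ r * L ^ kk) M) × Fin (d + 1) => blockOf (L ^ r * L ^ kk) M x.1))
      (BlockNorm.ofBlocks (unitTorusGeo L kk M) (fun x : Tor (fine (L ^ r * L ^ kk) M) × Fin (d + 1) => blockOf (L ^ r * L ^ kk) M x.1)) (TB' μ)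
      (fun y y' => ind ((cubeBlocks M c S : Finset _) : Set _) y * ind ((cubeBlocks M c S : Finset _) : Set _) y' * (β₁ * Real.exp (-(δ₀ * tdistT M y y')))))
    -- the two-sided defects
    (hIG : HasMaj (BlockNorm.ofBlocks (unitTorusGeo L kk M) (fun b : Tor (fine (L ^ kk) M) × Fin (d + 1) => blockOf (L ^ kk) M b.1))
      (BlockNorm.ofBlocks (unitTorusGeo L kk M) (fun x : Tor (fine (L ^ r * L ^ kk) M) × Fin (d + 1) => blockOf (L ^ r * L ^ kk) M x.1))
      (idef (pull (kingPrV L kk r M)) (pull (kingPrV L kk r M)) (mulOp (chiCube M (L ^ r * L ^ kk) c S) ∘ₗ Gc') (mulOp (chiCube M (L ^ kk) c S) ∘ₗ Gc))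
      (fun y y' => ind ((cubeBlocks M c S : Finset _) : Set _) y * ind ((cubeBlocks M c S : Finset _) : Set _) y' * (mG * Real.exp (-(δ₀ * tdistT M y y')))))
    (hITD : ∀ μ, HasMaj (BlockNorm.ofBlocks (unitTorusGeo L kk M) (fun b : Tor (fine (L ^ kk) M) × Fin (d + 1) => blockOf (L ^ kk) M b.1))
      (BlockNorm.ofBlocks (unitTorusGeo L kk M) (fun x : Tor (fine (L ^ r * L ^ kk) M) × Fin (d + 1) => blockOf (L ^ r * L ^ kk) M x.1))
      (idef (pull (kingPrV L kk r M)) (pull (kingPrV L kk r M)) (TD' μ) (TD μ))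
      (fun y y' => ind ((cubeBlocks M c S : Finset _) : Set _) y * ind ((cubeBlocks M c S : Finset _) : Set _) y' * (m₁ * Real.exp (-(δ₀ * tdistT M y y')))))
    (hITB : ∀ μ, HasMaj (BlockNorm.ofBlocks (unitTorusGeo L kk M) (fun b : Tor (fine (L ^ kk) M) × Fin (d + 1) => blockOf (L ^ kk) M b.1))
      (BlockNorm.ofBlocks (unitTorusGeo L kk M) (fun x : Tor (fine (L ^ r * L ^ kk) M) × Fin (d + 1) => blockOf (L ^ r * L ^ kk) M x.1))
      (idef (pull (kingPrV L kk r M)) (pull (kingPrV L kk r M)) (TB' μ) (TB μ))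
      (fun y y' => ind ((cubeBlocks M c S : Finset _) : Set _) y * ind ((cubeBlocks M c S : Finset _) : Set _) y' * (m₁ * Real.exp (-(δ₀ * tdistT M y y')))))
    -- the nonlocal part's defect
    (hDN : HasMaj (BlockNorm.ofBlocks (unitTorusGeo L kk M) (fun b : Tor (fine (L ^ kk) M) × Fin (d + 1) => blockOf (L ^ kk) M b.1))
      (BlockNorm.ofBlocks (unitTorusGeo L kk M) (fun x : Tor (fine (L ^ r * L ^ kk) M) × Fin (d + 1) => blockOf (L ^ r * L ^ kk) M x.1))
      (idef (pull (kingPrV L kk r M)) (pull (kingPrV L kk r M))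
        ((mulOp (chiCube M (L ^ r * L ^ kk) c S) ∘ₗ Gc') ∘ₗ
          commOp (a • (qvAdjRe M (L ^ r * L ^ kk) ∘ₗ qvRe M (L ^ r * L ^ kk)) + (-landauRe M (L ^ r * L ^ kk))) (hcube (2 * q) (coverXi M (L ^ r * L ^ kk) w) k))
        ((mulOp (chiCube M (L ^ kk) c S) ∘ₗ Gc) ∘ₗ
          commOp (a • (qvAdjRe M (L ^ kk) ∘ₗ qvRe M (L ^ kk)) + (-landauRe M (L ^ kk))) (hcube (2 * q) (coverXi M (L ^ kk) w) k)))
      (fun y y' => ind ((cubeBlocks M c S : Finset _) : Set _) y * (rN * Real.exp (-(ρ * tdistT M y y'))))) :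
    HasMaj (BlockNorm.ofBlocks (unitTorusGeo L kk M) (fun b : Tor (fine (L ^ kk) M) × Fin (d + 1) => blockOf (L ^ kk) M b.1))
      (BlockNorm.ofBlocks (unitTorusGeo L kk M) (fun x : Tor (fine (L ^ r * L ^ kk) M) × Fin (d + 1) => blockOf (L ^ r * L ^ kk) M x.1))
      (idef (pull (kingPrV L kk r M)) (pull (kingPrV L kk r M))
        ((mulOp (chiCube M (L ^ r * L ^ kk) c S) ∘ₗ Gc') ∘ₗ
          commOp (deltaOp M (L ^ r * L ^ kk) a) (hcube (2 * q) (coverXi M (L ^ r * L ^ kk) w) k))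
        ((mulOp (chiCube M (L ^ kk) c S) ∘ₗ Gc) ∘ₗ
          commOp (deltaOp M (L ^ kk) a) (hcube (2 * q) (coverXi M (L ^ kk) w) k)))
      (fun y y' => ind ((cubeBlocks M c S : Finset _) : Set _) y *
        (((Fintype.card (Fin (d + 1)) : ℝ) * (3 * (β * (((w : ℝ))⁻¹ ^ 2 * (((L ^ kk : ℕ) : ℝ) * w)⁻¹ * (144 * π ^ 3 + 32 * π ^ 3 * Fintype.card (Fin (d + 1)))) +
              mG * (32 * π ^ 2 / (w : ℝ) ^ 2)) +
            2 * (β₁ * (|((w : ℝ))⁻¹| * (((L ^ kk : ℕ) : ℝ) * w)⁻¹ * (64 * π ^ 2 + π ^ 2 * Fintype.card (Fin (d + 1)))) + m₁ * (π / w))) + 0 + rN) *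
          Real.exp (-(ρ * tdistT M y y')))) := by
  have hL1 : 1 ≤ L := Nat.pos_of_ne_zero (NeZero.ne L)
  have hwR : (0 : ℝ) < w := by exact_mod_cast hw
  have hc₁ : (0 : ℝ) ≤ π / w := by positivity
  have hc₂ : (0 : ℝ) ≤ 32 * π ^ 2 / (w : ℝ) ^ 2 := by positivity
  have ho₁ : (0 : ℝ) ≤ |((w : ℝ))⁻¹| * (((L ^ kk : ℕ) : ℝ) * w)⁻¹ * (64 * π ^ 2 + π ^ 2 * Fintype.card (Fin (d + 1))) := by positivity
  have ho₂ : (0 : ℝ) ≤ ((w : ℝ))⁻¹ ^ 2 * (((L ^ kk : ℕ) : ℝ) * w)⁻¹ * (144 * π ^ 3 + 32 * π ^ 3 * Fintype.card (Fin (d + 1))) := by positivity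
  -- the coarse partition letters in §2's shapes
  have hh2 := fun μ x => abs_fgradAdj_fgrad_coverH_le (n := L ^ kk) hM hw k μ x
  have hhD : ∀ (μ : Fin (d + 1)) (x : Tor (fine (L ^ kk) M) × Fin (d + 1)),
      |(fgrad ((L ^ kk : ℕ) : ℝ) (bshiftEquiv M (L ^ kk) μ) (hcube (2 * q) (coverXi M (L ^ kk) w) k) ∘ ⇑(bshiftEquiv M (L ^ kk) μ).symm) x| ≤ π / w := fun μ x => by
    rw [fgrad_comp_symm_eq_bgrad]; exact abs_bgrad_coverH_le hM hw k μ x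
  have hhB : ∀ (μ : Fin (d + 1)) (x : Tor (fine (L ^ kk) M) × Fin (d + 1)),
      |(bgrad ((L ^ kk : ℕ) : ℝ) (bshiftEquiv M (L ^ kk) μ) (hcube (2 * q) (coverXi M (L ^ kk) w) k) ∘ ⇑(bshiftEquiv M (L ^ kk) μ)) x| ≤ π / w := fun μ x => by
    rw [bgrad_comp_eq_fgrad]; exact abs_fgrad_coverH_le hM hw k μ x
  have hh2f : ∀ (μ : Fin (d + 1)) (x : Tor (fine (L ^ kk) M) × Fin (d + 1)),
      |(fgrad ((L ^ kk : ℕ) : ℝ) (bshiftEquiv M (L ^ kk) μ) (fgrad ((L ^ kk : ℕ) : ℝ) (bshiftEquiv M (L ^ kk) μ) (hcube (2 * q) (coverXi M (L ^ kk) w) k)) ∘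
        ⇑(bshiftEquiv M (L ^ kk) μ).symm) x| ≤ 32 * π ^ 2 / (w : ℝ) ^ 2 := fun μ x => by
    rw [Function.comp_apply, fgrad_fgrad_apply_eq, Equiv.apply_symm_apply, abs_neg]; exact hh2 μ x
  have hh2b : ∀ (μ : Fin (d + 1)) (x : Tor (fine (L ^ kk) M) × Fin (d + 1)),
      |bgrad ((L ^ kk : ℕ) : ℝ) (bshiftEquiv M (L ^ kk) μ) (bgrad ((L ^ kk : ℕ) : ℝ) (bshiftEquiv M (L ^ kk) μ) (hcube (2 * q) (coverXi M (L ^ kk) w) k) ∘ ⇑(bshiftEquiv M (L ^ kk) μ)) x| ≤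
        32 * π ^ 2 / (w : ℝ) ^ 2 := fun μ x => by
    rw [bgrad_comp_eq_fgrad, bgrad_fgrad_apply_eq, abs_neg]; exact hh2 μ x
  -- the two-grid fits (FILES 64∕65 with FILE 74's plumbing)
  obtain ⟨hs0, hs13, hs1', hs1, hsL, hnκ, hnκ'⟩ := coverFit_params (L := L) (kk := kk) (r := r) (w := w) hL1 hw h3
  have hξ := fun μ ν b => coverXi_shift (n := L ^ kk) hM hw μ ν b
  have hξ' := fun μ ν b => coverXi_shift (n := L ^ r * L ^ kk) hM hw μ ν b
  have hoff := fun ν x' => coverXi_offset (M := M) (L := L) (kk := kk) (r := r) (w := w) (q := q) ν x'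
  have hq : 0 < q := by
    rcases Nat.eq_zero_or_pos q with h | h
    · exfalso; have := NeZero.ne (M 0); rw [hM 0, h] at this; simp at this
    · exact h
  have hK2 : 2 ≤ 2 * q := by omega
  have hLr : 1 ≤ L ^ r := Nat.one_le_pow _ _ hL1
  have hf1 := fun μ x' => abs_fgrad_hcube_two_grid_le (2 * q) (coverXi M (L ^ kk) w) (coverXi M (L ^ r * L ^ kk) w) (kingPrV L kk r M) (bshiftEquiv M (L ^ kk))
    (bshiftEquiv M (L ^ r * L ^ kk)) hK2 hLr hs0 hs1' hsL hnκ hnκ' hξ hξ' hoff k μ x'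
  have hf1b := fun μ x' => abs_bgrad_hcube_two_grid_le (2 * q) (coverXi M (L ^ kk) w) (coverXi M (L ^ r * L ^ kk) w) (kingPrV L kk r M) (bshiftEquiv M (L ^ kk))
    (bshiftEquiv M (L ^ r * L ^ kk)) hK2 hLr hs0 hs1' hsL hnκ hnκ' hξ hξ' hoff k μ x'
  have hf2 := fun μ x' => abs_fgradAdj_fgrad_hcube_two_grid_le (2 * q) (coverXi M (L ^ kk) w) (coverXi M (L ^ r * L ^ kk) w) (kingPrV L kk r M) (bshiftEquiv M (L ^ kk))
    (bshiftEquiv M (L ^ r * L ^ kk)) hK2 hLr hs0 hs13 hs1 hsL hnκ hnκ' hξ hξ' hoff k μ x'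
  have hfD : ∀ (μ : Fin (d + 1)) (x' : Tor (fine (L ^ r * L ^ kk) M) × Fin (d + 1)),
      |(fgrad ((L ^ r * L ^ kk : ℕ) : ℝ) (bshiftEquiv M (L ^ r * L ^ kk) μ) (hcube (2 * q) (coverXi M (L ^ r * L ^ kk) w) k) ∘ ⇑(bshiftEquiv M (L ^ r * L ^ kk) μ).symm) x' -
        (fgrad ((L ^ kk : ℕ) : ℝ) (bshiftEquiv M (L ^ kk) μ) (hcube (2 * q) (coverXi M (L ^ kk) w) k) ∘ ⇑(bshiftEquiv M (L ^ kk) μ).symm) (kingPrV L kk r M x')| ≤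
        |((w : ℝ))⁻¹| * (((L ^ kk : ℕ) : ℝ) * w)⁻¹ * (64 * π ^ 2 + π ^ 2 * Fintype.card (Fin (d + 1))) := fun μ x' => by
    rw [fgrad_comp_symm_eq_bgrad, fgrad_comp_symm_eq_bgrad]; exact hf1b μ x'
  have hfB : ∀ (μ : Fin (d + 1)) (x' : Tor (fine (L ^ r * L ^ kk) M) × Fin (d + 1)),
      |(bgrad ((L ^ r * L ^ kk : ℕ) : ℝ) (bshiftEquiv M (L ^ r * L ^ kk) μ) (hcube (2 * q) (coverXi M (L ^ r * L ^ kk) w) k) ∘ ⇑(bshiftEquiv M (L ^ r * L ^ kk) μ)) x' -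
        (bgrad ((L ^ kk : ℕ) : ℝ) (bshiftEquiv M (L ^ kk) μ) (hcube (2 * q) (coverXi M (L ^ kk) w) k) ∘ ⇑(bshiftEquiv M (L ^ kk) μ)) (kingPrV L kk r M x')| ≤
        |((w : ℝ))⁻¹| * (((L ^ kk : ℕ) : ℝ) * w)⁻¹ * (64 * π ^ 2 + π ^ 2 * Fintype.card (Fin (d + 1))) := fun μ x' => by
    rw [bgrad_comp_eq_fgrad, bgrad_comp_eq_fgrad]; exact hf1 μ x'
  have hf2f : ∀ (μ : Fin (d + 1)) (x' : Tor (fine (L ^ r * L ^ kk) M) × Fin (d + 1)),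
      |(fgrad ((L ^ r * L ^ kk : ℕ) : ℝ) (bshiftEquiv M (L ^ r * L ^ kk) μ) (fgrad ((L ^ r * L ^ kk : ℕ) : ℝ) (bshiftEquiv M (L ^ r * L ^ kk) μ)
          (hcube (2 * q) (coverXi M (L ^ r * L ^ kk) w) k)) ∘ ⇑(bshiftEquiv M (L ^ r * L ^ kk) μ).symm) x' -
        (fgrad ((L ^ kk : ℕ) : ℝ) (bshiftEquiv M (L ^ kk) μ) (fgrad ((L ^ kk : ℕ) : ℝ) (bshiftEquiv M (L ^ kk) μ) (hcube (2 * q) (coverXi M (L ^ kk) w) k)) ∘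
          ⇑(bshiftEquiv M (L ^ kk) μ).symm) (kingPrV L kk r M x')| ≤
        ((w : ℝ))⁻¹ ^ 2 * (((L ^ kk : ℕ) : ℝ) * w)⁻¹ * (144 * π ^ 3 + 32 * π ^ 3 * Fintype.card (Fin (d + 1))) := fun μ x' => by
    rw [Function.comp_apply, Function.comp_apply, fgrad_fgrad_apply_eq, fgrad_fgrad_apply_eq, Equiv.apply_symm_apply, Equiv.apply_symm_apply, ← abs_neg]
    convert hf2 μ x' using 2; ring
  have hf2b : ∀ (μ : Fin (d + 1)) (x' : Tor (fine (L ^ r * L ^ kk) M) × Fin (d + 1)),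
      |bgrad ((L ^ r * L ^ kk : ℕ) : ℝ) (bshiftEquiv M (L ^ r * L ^ kk) μ) (bgrad ((L ^ r * L ^ kk : ℕ) : ℝ) (bshiftEquiv M (L ^ r * L ^ kk) μ)
          (hcube (2 * q) (coverXi M (L ^ r * L ^ kk) w) k) ∘ ⇑(bshiftEquiv M (L ^ r * L ^ kk) μ)) x' -
        bgrad ((L ^ kk : ℕ) : ℝ) (bshiftEquiv M (L ^ kk) μ) (bgrad ((L ^ kk : ℕ) : ℝ) (bshiftEquiv M (L ^ kk) μ) (hcube (2 * q) (coverXi M (L ^ kk) w) k) ∘ ⇑(bshiftEquiv M (L ^ kk) μ))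
          (kingPrV L kk r M x')| ≤ ((w : ℝ))⁻¹ ^ 2 * (((L ^ kk : ℕ) : ℝ) * w)⁻¹ * (144 * π ^ 3 + 32 * π ^ 3 * Fintype.card (Fin (d + 1))) := fun μ x' => by
    rw [bgrad_comp_eq_fgrad, bgrad_comp_eq_fgrad, bgrad_fgrad_apply_eq, bgrad_fgrad_apply_eq, ← abs_neg]
    convert hf2 μ x' using 2; ring
  -- the `W = 0` defect
  have hDW : HasMaj (BlockNorm.ofBlocks (unitTorusGeo L kk M) (fun b : Tor (fine (L ^ kk) M) × Fin (d + 1) => blockOf (L ^ kk) M b.1))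
      (BlockNorm.ofBlocks (unitTorusGeo L kk M) ((fun b : Tor (fine (L ^ kk) M) × Fin (d + 1) => blockOf (L ^ kk) M b.1) ∘ kingPrV L kk r M))
      (idef (pull (kingPrV L kk r M)) (pull (kingPrV L kk r M))
        ((mulOp (chiCube M (L ^ r * L ^ kk) c S) ∘ₗ Gc') ∘ₗ
          commOp (0 : (Tor (fine (L ^ r * L ^ kk) M) × Fin (d + 1) → ℝ) →ₗ[ℝ] (Tor (fine (L ^ r * L ^ kk) M) × Fin (d + 1) → ℝ)) (hcube (2 * q) (coverXi M (L ^ r * L ^ kk) w) k))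
        ((mulOp (chiCube M (L ^ kk) c S) ∘ₗ Gc) ∘ₗ
          commOp (0 : (Tor (fine (L ^ kk) M) × Fin (d + 1) → ℝ) →ₗ[ℝ] (Tor (fine (L ^ kk) M) × Fin (d + 1) → ℝ)) (hcube (2 * q) (coverXi M (L ^ kk) w) k)))
      (fun y y' => ind ((cubeBlocks M c S : Finset _) : Set _) y * ind ((cubeBlocks M c S : Finset _) : Set _) y' *
        (0 * Real.exp (-(δ₀ * (unitTorusGeo L kk M).dist y y')))) := by
    rw [commOp_zero_left, commOp_zero_left, LinearMap.comp_zero, LinearMap.comp_zero, idef_zero]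
    exact (hasMaj_zero _ _).mono fun y y' => le_of_eq (by ring)
  -- King's pairing of fine blocks
  have hblk : (fun x : Tor (fine (L ^ r * L ^ kk) M) × Fin (d + 1) => blockOf (L ^ r * L ^ kk) M x.1) =
      (fun b : Tor (fine (L ^ kk) M) × Fin (d + 1) => blockOf (L ^ kk) M b.1) ∘ kingPrV L kk r M := (VectorPiece.blkFine_comp_kingPrV (M := M) L kk r).symm
  rw [hblk] at hGc' hTD' hTB' hIG hITD hITB hDN ⊢
  -- THE LOCAL PART (§1)
  have hloc := hasMaj_idef_comp_commOp_lapOp_of_sandwich (g := unitTorusGeo L kk M) (fun b : Tor (fine (L ^ kk) M) × Fin (d + 1) => blockOf (L ^ kk) M b.1) (kingPrV L kk r M)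
    (S := ((cubeBlocks M c S : Finset _) : Set _)) hβ hβ₁ hc₁ hc₂ ho₁ ho₂ hmG hm₁ hhD hhB hh2 hh2f hh2b hfD hfB hf2 hf2f hf2b hsD hsB hsD' hsB'
    hGc' hTD' hTB' hIG hITD hITB hDW
  -- THE SUM with the displayed nonlocal defect
  rw [deltaOp_eq_lapOp_zero_add, deltaOp_eq_lapOp_zero_add, commOp_add_left (lapOp _ _ _), commOp_add_left (lapOp _ _ _), LinearMap.comp_add, LinearMap.comp_add,
    idef_add]
  have hθ : (0 : ℝ) ≤ (Fintype.card (Fin (d + 1)) : ℝ) * (3 * (β * (((w : ℝ))⁻¹ ^ 2 * (((L ^ kk : ℕ) : ℝ) * w)⁻¹ * (144 * π ^ 3 + 32 * π ^ 3 * Fintype.card (Fin (d + 1)))) +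
        mG * (32 * π ^ 2 / (w : ℝ) ^ 2)) +
      2 * (β₁ * (|((w : ℝ))⁻¹| * (((L ^ kk : ℕ) : ℝ) * w)⁻¹ * (64 * π ^ 2 + π ^ 2 * Fintype.card (Fin (d + 1)))) + m₁ * (π / w))) + 0 := by positivity
  refine (hloc.add hDN).mono fun y y' => ?_
  have t1 := loc₂_le_loc₁ (L := L) (kk := kk) (S := ((cubeBlocks M c S : Finset _) : Set _)) hθ hρδ y y'
  refine (add_le_add t1 le_rfl).trans (le_of_eq ?_)
  simp only [unitTorusGeo, Fintype.card_fin]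
  ring

/-- ★★★ **THE TWO-GRID η-DEFECT OF A CUT CUBE's ROW AGAINST THE COMMUTATOR OF THE NONLOCAL PART, GENERIC IN THE CUBE OPERATOR** — FILE 100 §2
`hasMaj_idef_chiCube_neumannCubeG_comp_commOp_nonlocal_of` with the fine two-sided cut row `M_{χ′}G′_c ≤ 1_□1_□βe^{−δ₀d}` DISPLAYED instead of derived (programme R: the cube operator on the
torus of record is the LIFTED Neumann cube).  On `M_ν = 2qw`, partition `h = h_k` of FILE 67 at both spacings, `N_L = a•Q*Q − ∂Π∂*`, displayed `∂Π∂* ≤ C₁e^{−δ₀d}` (both spacings), two-sided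
`𝔇(M_{χ′}G′_c, M_χG_c) ≤ 1_□1_□m_Ge^{−δ₀d}` and the operator letter `𝔇(N′_L, N_L) ≤ r_Ne^{−δ₀d}` (FILE 99):
  `𝔇((M_{χ′}G′_c)∘[N′_L, M_{h′}], (M_χG_c)∘[N_L, M_h]) ≤ 1_□(y)·(β(K₁r_N + 2o c_N) + m_G K₁c_N)·c_r·e^{−(δ₀∕2)d}`,
`c_N = |a|e^{δ₀}e^{δ₀} + C₁`, `ℓ = ω = π(d+1)∕w`, `o = π(d+1)∕(L^Kw)`, `K₁ = ℓ(e·δ₀∕4)⁻¹ + 2ω`, `c_r = latticeConst (d+1) (δ₀∕4)` — Leibniz, FILE 56 `hasMaj_idef_commOp_nonlocal` ∕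
`hasMaj_commOp_nonlocal`, FILE 57 `hasMaj_comp_exp_out`, FILE 67's moduli. [cite: Balaban1984PropagatorsI, (1.120)–(1.121) p.37, (1.126)–(1.128) p.38 (shape + mechanism);
Balaban1985BackgroundPropagators, Thm 3.14 pp.426–427 (difference template)] -/
theorem hasMaj_idef_cut_comp_commOp_nonlocal_of_row (hM : ∀ ν, M ν = 2 * q * w) (hw : 0 < w) (k : Fin (d + 1) → ZMod (2 * q)) (c : Tor M) (S : ℕ)
    {Gc : (Tor (fine (L ^ kk) M) × Fin (d + 1) → ℝ) →ₗ[ℝ] (Tor (fine (L ^ kk) M) × Fin (d + 1) → ℝ)}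
    {Gc' : (Tor (fine (L ^ r * L ^ kk) M) × Fin (d + 1) → ℝ) →ₗ[ℝ] (Tor (fine (L ^ r * L ^ kk) M) × Fin (d + 1) → ℝ)}
    {a β δ₀ C₁ mG rN : ℝ} (hβ : 0 ≤ β) (hδ₀ : 0 < δ₀) (hC₁ : 0 ≤ C₁) (hmG : 0 ≤ mG) (hrN : 0 ≤ rN)
    (hGc' : HasMaj (BlockNorm.ofBlocks (unitTorusGeo L kk M) (fun x : Tor (fine (L ^ r * L ^ kk) M) × Fin (d + 1) => blockOf (L ^ r * L ^ kk) M x.1))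
      (BlockNorm.ofBlocks (unitTorusGeo L kk M) (fun x : Tor (fine (L ^ r * L ^ kk) M) × Fin (d + 1) => blockOf (L ^ r * L ^ kk) M x.1))
      (mulOp (chiCube M (L ^ r * L ^ kk) c S) ∘ₗ Gc')
      (fun y y' => ind ((cubeBlocks M c S : Finset _) : Set _) y * ind ((cubeBlocks M c S : Finset _) : Set _) y' * (β * Real.exp (-(δ₀ * tdistT M y y')))))
    (hNL : HasMaj (BlockNorm.ofBlocks (unitTorusGeo L kk M) (fun b : Tor (fine (L ^ kk) M) × Fin (d + 1) => blockOf (L ^ kk) M b.1))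
      (BlockNorm.ofBlocks (unitTorusGeo L kk M) (fun b : Tor (fine (L ^ kk) M) × Fin (d + 1) => blockOf (L ^ kk) M b.1)) (landauRe M (L ^ kk))
      (fun y y' => C₁ * Real.exp (-(δ₀ * tdistT M y y'))))
    (hNL' : HasMaj (BlockNorm.ofBlocks (unitTorusGeo L kk M) (fun x : Tor (fine (L ^ r * L ^ kk) M) × Fin (d + 1) => blockOf (L ^ r * L ^ kk) M x.1))
      (BlockNorm.ofBlocks (unitTorusGeo L kk M) (fun x : Tor (fine (L ^ r * L ^ kk) M) × Fin (d + 1) => blockOf (L ^ r * L ^ kk) M x.1)) (landauRe M (L ^ r * L ^ kk))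
      (fun y y' => C₁ * Real.exp (-(δ₀ * tdistT M y y'))))
    (hIG : HasMaj (BlockNorm.ofBlocks (unitTorusGeo L kk M) (fun b : Tor (fine (L ^ kk) M) × Fin (d + 1) => blockOf (L ^ kk) M b.1))
      (BlockNorm.ofBlocks (unitTorusGeo L kk M) (fun x : Tor (fine (L ^ r * L ^ kk) M) × Fin (d + 1) => blockOf (L ^ r * L ^ kk) M x.1))
      (idef (pull (kingPrV L kk r M)) (pull (kingPrV L kk r M))
        (mulOp (chiCube M (L ^ r * L ^ kk) c S) ∘ₗ Gc')
        (mulOp (chiCube M (L ^ kk) c S) ∘ₗ Gc))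
      (fun y y' => ind ((cubeBlocks M c S : Finset _) : Set _) y * ind ((cubeBlocks M c S : Finset _) : Set _) y' *
        (mG * Real.exp (-(δ₀ * tdistT M y y')))))
    (hDN : HasMaj (BlockNorm.ofBlocks (unitTorusGeo L kk M) (fun b : Tor (fine (L ^ kk) M) × Fin (d + 1) => blockOf (L ^ kk) M b.1))
      (BlockNorm.ofBlocks (unitTorusGeo L kk M) (fun x : Tor (fine (L ^ r * L ^ kk) M) × Fin (d + 1) => blockOf (L ^ r * L ^ kk) M x.1))
      (idef (pull (kingPrV L kk r M)) (pull (kingPrV L kk r M))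
        (a • (qvAdjRe M (L ^ r * L ^ kk) ∘ₗ qvRe M (L ^ r * L ^ kk)) + (-landauRe M (L ^ r * L ^ kk))) (a • (qvAdjRe M (L ^ kk) ∘ₗ qvRe M (L ^ kk)) + (-landauRe M (L ^ kk))))
      (fun y y' => rN * Real.exp (-(δ₀ * tdistT M y y')))) :
    HasMaj (BlockNorm.ofBlocks (unitTorusGeo L kk M) (fun b : Tor (fine (L ^ kk) M) × Fin (d + 1) => blockOf (L ^ kk) M b.1))
      (BlockNorm.ofBlocks (unitTorusGeo L kk M) (fun x : Tor (fine (L ^ r * L ^ kk) M) × Fin (d + 1) => blockOf (L ^ r * L ^ kk) M x.1))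
      (idef (pull (kingPrV L kk r M)) (pull (kingPrV L kk r M))
        ((mulOp (chiCube M (L ^ r * L ^ kk) c S) ∘ₗ Gc') ∘ₗ
          commOp (a • (qvAdjRe M (L ^ r * L ^ kk) ∘ₗ qvRe M (L ^ r * L ^ kk)) + (-landauRe M (L ^ r * L ^ kk))) (hcube (2 * q) (coverXi M (L ^ r * L ^ kk) w) k))
        ((mulOp (chiCube M (L ^ kk) c S) ∘ₗ Gc) ∘ₗ
          commOp (a • (qvAdjRe M (L ^ kk) ∘ₗ qvRe M (L ^ kk)) + (-landauRe M (L ^ kk))) (hcube (2 * q) (coverXi M (L ^ kk) w) k)))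
      (fun y y' => ind ((cubeBlocks M c S : Finset _) : Set _) y *
        (((β * ((π * (d + 1) / w * (Real.exp 1 * (δ₀ / 4))⁻¹ + 2 * (π * (d + 1) / w)) * rN +
              2 * (π * (d + 1) / (((L ^ kk : ℕ) : ℝ) * w)) * (|a| * (Real.exp δ₀ * Real.exp δ₀) + C₁)) +
            mG * ((π * (d + 1) / w * (Real.exp 1 * (δ₀ / 4))⁻¹ + 2 * (π * (d + 1) / w)) * (|a| * (Real.exp δ₀ * Real.exp δ₀) + C₁))) *
            B4Sect5Proof.latticeConst (d + 1) (δ₀ / 4)) *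
          Real.exp (-(δ₀ / 2 * tdistT M y y')))) := by
  have hwR : (0 : ℝ) < w := by exact_mod_cast hw
  have hcN : 0 ≤ |a| * (Real.exp δ₀ * Real.exp δ₀) + C₁ := by positivity
  have hℓ : (0 : ℝ) ≤ π * (d + 1) / w := by positivity
  have ho : (0 : ℝ) ≤ π * (d + 1) / (((L ^ kk : ℕ) : ℝ) * w) := by positivity
  have hε : (0 : ℝ) < δ₀ / 4 := by positivity
  have hcr : 0 ≤ B4Sect5Proof.latticeConst (d + 1) (δ₀ / 4) := B4Sect5Proof.latticeConst_nonneg (d + 1) hε.le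
  -- the letters of the nonlocal part at both spacings
  have hN := hasMaj_nonlocalPart (L := L) (kk := kk) (a := a) hC₁ hδ₀.le le_rfl hNL
  have hN' := hasMaj_nonlocalPart (L := L) (kk := kk) (a := a) hC₁ hδ₀.le le_rfl hNL'
  -- the partition's moduli (FILE 67)
  have hLip := fun y y' => abs_coverHb_sub_le (n := L ^ kk) hM hw k y y'
  have hr := fun x => abs_coverH_sub_coverHb_le (n := L ^ kk) hM hw k x
  have hr' : ∀ x' : Tor (fine (L ^ r * L ^ kk) M) × Fin (d + 1),
      |hcube (2 * q) (coverXi M (L ^ r * L ^ kk) w) k x' - coverHb M (L ^ kk) w q k (blockOf (L ^ kk) M (kingPrV L kk r M x').1)| ≤ π * (d + 1) / w := fun x' => by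
    have h1 := abs_coverH_sub_coverHb_le (n := L ^ r * L ^ kk) hM hw k x'
    rw [coverHb_eq_of_spacing (L ^ kk) (L ^ r * L ^ kk) hw, blockOf_fine_eq] at h1
    exact h1
  have hfit := fun x' => abs_coverH_fine_sub_le (L := L) (kk := kk) (r := r) hM hw k x'
  -- King's pairing of fine blocks
  have hblk : (fun x : Tor (fine (L ^ r * L ^ kk) M) × Fin (d + 1) => blockOf (L ^ r * L ^ kk) M x.1) =
      (fun b : Tor (fine (L ^ kk) M) × Fin (d + 1) => blockOf (L ^ kk) M b.1) ∘ kingPrV L kk r M := (VectorPiece.blkFine_comp_kingPrV (M := M) L kk r).symm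
  rw [hblk] at hGc' hN' hIG hDN ⊢
  -- the η-defect of `[N′, M_{h′}]` against `[N, M_h]` (FILE 56) and the commutator letter of `[N, M_h]`
  have hDC := hasMaj_idef_commOp_nonlocal (g := unitTorusGeo L kk M) (fun b : Tor (fine (L ^ kk) M) × Fin (d + 1) => blockOf (L ^ kk) M b.1) (kingPrV L kk r M)
    (hb := coverHb M (L ^ kk) w q k) (h := hcube (2 * q) (coverXi M (L ^ kk) w) k) (h' := hcube (2 * q) (coverXi M (L ^ r * L ^ kk) w) k)
    hcN hrN hℓ hℓ ho hε (unitTorusGeo_dist_nonneg L kk M) (unitTorusGeo_dist_symm L kk M) hLip hr hr' hfit hN hN' hDN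
  have hCN := hasMaj_commOp_nonlocal (g := unitTorusGeo L kk M) (fun b : Tor (fine (L ^ kk) M) × Fin (d + 1) => blockOf (L ^ kk) M b.1)
    (hb := coverHb M (L ^ kk) w q k) (h := hcube (2 * q) (coverXi M (L ^ kk) w) k) hcN hℓ hℓ hε (unitTorusGeo_dist_nonneg L kk M) (unitTorusGeo_dist_symm L kk M) hLip hr hN
  -- both pieces keep the output indicator (FILE 57)
  have hrow := rowSum_unitTorusGeo (L := L) (k := kk) (M := M) (σ := δ₀ / 4) hε
  have hK2 : 0 ≤ ((π * (d + 1) / w * (Real.exp 1 * (δ₀ / 4))⁻¹ + 2 * (π * (d + 1) / w)) * rN + 2 * (π * (d + 1) / (((L ^ kk : ℕ) : ℝ) * w)) * (|a| * (Real.exp δ₀ * Real.exp δ₀) + C₁)) := by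
    positivity
  have hK3 : 0 ≤ (π * (d + 1) / w * (Real.exp 1 * (δ₀ / 4))⁻¹ + 2 * (π * (d + 1) / w)) * (|a| * (Real.exp δ₀ * Real.exp δ₀) + C₁) := by positivity
  have hT1 := hasMaj_comp_exp_out (g := unitTorusGeo L kk M) ((fun b : Tor (fine (L ^ kk) M) × Fin (d + 1) => blockOf (L ^ kk) M b.1) ∘ kingPrV L kk r M)
    (triangle254_unitTorusGeo L kk M) (unitTorusGeo_dist_nonneg L kk M) hrow hβ hK2 (by positivity : (0 : ℝ) ≤ δ₀ / 2) (by linarith : δ₀ / 2 ≤ δ₀ - δ₀ / 4)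
    (by linarith : δ₀ / 2 + δ₀ / 4 ≤ δ₀) hGc' hDC
  have hT2 := hasMaj_comp_exp_out (g := unitTorusGeo L kk M) (fun b : Tor (fine (L ^ kk) M) × Fin (d + 1) => blockOf (L ^ kk) M b.1)
    (triangle254_unitTorusGeo L kk M) (unitTorusGeo_dist_nonneg L kk M) hrow hmG hK3 (by positivity : (0 : ℝ) ≤ δ₀ / 2) (by linarith : δ₀ / 2 ≤ δ₀ - δ₀ / 4)
    (by linarith : δ₀ / 2 + δ₀ / 4 ≤ δ₀) hIG hCN
  -- Leibniz
  rw [idef_comp (pull (kingPrV L kk r M)) (pull (kingPrV L kk r M)) (pull (kingPrV L kk r M))]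
  refine (hT1.add hT2).mono fun y y' => le_of_eq ?_
  simp only [unitTorusGeo]
  ring


end Cube

end Summit.QuantumFields.YangMills.BalabanUVNodes.N15.Gluing

end
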